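import Literature.MathematicalPhysics.QuantumFieldTheory.Chatterjee2019LargeN.MasterLoopLimit
import Literature.MathematicalPhysics.QuantumFieldTheory.Chatterjee2019LargeN.CoeffCatalanBound
import HarnessLib

/-!
# Chatterjee 2019, Theorem 9.9 (the symmetrized master loop equation in the 't Hooft limit) — from Theorem 3.1, and (v1.1) from Theorem 8.1 by the printed symmetrization

S. Chatterjee, *Rigorous solution of strongly coupled `SO(N)` lattice gauge theory in the large `N` limit*,
Comm. Math. Phys. **366** (2019) 203–268 (arXiv:1502.07719), **Theorem 9.9**: «for any non-null loop sequence `s` and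
`|β| ≤ β₀(d)`, `|s| φ_β(s) = Σ_{s'∈𝕊⁻(s)} φ_β(s') − Σ_{s'∈𝕊⁺(s)} φ_β(s') + β Σ_{s'∈𝔻⁻(s)} φ_β(s') − β Σ_{s'∈𝔻⁺(s)} φ_β(s')`».

THEOREMS ONLY (net debt 0): `symmetrizedLimitMasterLoopEquation_of_gaugeStringDuality : GaugeStringDuality d →
SymmetrizedLimitMasterLoopEquation d`, and (v1.1, last section) ★ `symmetrizedLimitMasterLoopEquation_of_unsymmetrized :
UnsymmetrizedMasterLoopEquation d → SymmetrizedLimitMasterLoopEquation d` — THE PRINTED DIRECTION: the limiting marked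
equation of Theorem 9.1 (⇐ Theorem 8.1, sibling `MasterLoopLimit`) is symmetrized over the marked edge exactly as in the
printed proof of Theorem 3.6 (permutation invariance of `φ`, classes of equal-or-inverse edges, `∑_{e∈D_k} m_k(e) = |l_k|`,
sum over the components; `Word.sum_marked_avg`, `symmetrize_component`), for every `β`.  In print Theorem 9.9 is obtained
from Theorem 9.1 by this symmetrization (and is then used to prove Theorem 3.1); the first section records the converse
bookkeeping, which is the
first-step identity of the trajectory expansion: under gauge–string duality `φ_β(s) = Σ_{X ∈ 𝒳(s)} w_β(X)`
(absolutely convergent), and conditioning on the first move `s ↝ s'` of the trajectory (weights `∓1/|s|`, `∓β/|s|`;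
`𝒳(s) ≃ Σ_{s ↝ s'} 𝒳(s')`, `w_β(X) = w_β(s, s') w_β(X')`) gives
`φ_β(s) = Σ_{s ↝ s'} w_β(s, s') φ_β(s')`, i.e. the displayed equation (the produced `s'` are genuine loop sequences by
`LoopOperations`, so `φ_β(s')` is again the trajectory sum).  This is the `β`-resummed form of the argument of
Corollary 10.4 (`SymmetrizedCoeffRecursion_holds`, sibling module `MasterLoopEquation`).

## WHAT THIS IS NOT
Theorem 8.1 (`UnsymmetrizedMasterLoopEquation`) and Theorem 3.1 (`GaugeStringDuality`) remain named facts; the finite-`N`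
symmetrized equation (Theorem 3.6, `FiniteNMasterLoopEquation`, with its twisting and merger terms) is not derived here.
-/

noncomputable section

open Filter Topology
open Literature.Probability.LatticeModels Literature.MathematicalPhysics.QuantumLattice

namespace Literature.MathematicalPhysics.QuantumFieldTheory.Chatterjee2019LargeN

variable {d : ℕ}

/-- A genuine non-null loop sequence has positive total length `|s| ≥ 1`. [cite: Chatterjee2019LargeN, §9 (|s|, #s; Lemma 9.7)] -/
theorem LoopSeq.len_pos {s : LoopSeq d} (hs : IsLoopSeq s) (hne : s ≠ []) : 0 < s.len := by
  have h1 : 1 ≤ LoopSeq.size s := by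
    rw [LoopSeq.size]; exact List.length_pos_iff.mpr hne
  exact lt_of_lt_of_le (by omega) (LoopSeq.size_le_len fun l hl => (hs l hl).2)

/-- **First-step identity of the trajectory sum**: if `X ↦ w_β(X)` is summable over `𝒳(s')` for `s' = s` and for every
`s'` reached from the non-null `s` by one move, then `Σ_{X ∈ 𝒳(s)} w_β(X) = Σ_{s ↝ s'} w_β(s, s') Σ_{X' ∈ 𝒳(s')} w_β(X')`.
[cite: Chatterjee2019LargeN, §2.2 (w_β(X) = Π w_β(sᵢ, sᵢ₊₁)), Theorem 9.9] -/
theorem tsum_weight_eq_sum_moves {s : LoopSeq d} (hne : s ≠ []) (β : ℝ)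
    (hs : Summable fun X : Trajectory s => X.weight β)
    (hm : ∀ m : Move s, Summable fun X : Trajectory m.result => X.weight β) :
    HasSum (fun m : Move s => m.weight β * ∑' X : Trajectory m.result, X.weight β)
      (∑' X : Trajectory s, X.weight β) := by
  -- `𝒳(s) ≃ Σ_{s ↝ s'} 𝒳(s')` (first move and tail)
  let e : Trajectory s ≃ Σ m : Move s, Trajectory m.result :=
    { toFun := fun X => X.headTail hne
      invFun := fun p => Trajectory.cons p.1 p.2
      left_inv := fun X => by
        cases X with
        | nil => exact absurd rfl hne
        | cons m X => rfl
      right_inv := fun p => by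
        rcases p with ⟨m, Y⟩
        rfl }
  have h1 : HasSum (fun p : Σ m : Move s, Trajectory m.result => p.1.weight β * p.2.weight β)
      (∑' X : Trajectory s, X.weight β) := by
    have h := (e.symm.hasSum_iff (f := fun X : Trajectory s => X.weight β)).mpr hs.hasSum
    refine h.congr_fun ?_
    rintro ⟨m, Y⟩
    rfl
  exact h1.sigma fun m => (hm m).hasSum.mul_left (m.weight β)

/-- **Theorem 9.9 from Theorem 3.1, PROVED.** [cite: Chatterjee2019LargeN, Theorem 9.9; Theorem 3.1 (φ_β(s) = Σ_{X ∈ 𝒳(s)} w_β(X))] -/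
theorem symmetrizedLimitMasterLoopEquation_of_gaugeStringDuality (hG : GaugeStringDuality d) :
    SymmetrizedLimitMasterLoopEquation d := by
  intro hd
  obtain ⟨β₀, hβ₀, H⟩ := hG hd
  refine ⟨β₀, hβ₀, fun Λ hΛ β hβ φ hφ s hs hne => ?_⟩
  classical
  -- `φ = Σ_X w_β(X)` on genuine loop sequences
  set T : LoopSeq d → ℝ := fun t => ∑' X : Trajectory t, X.weight β with hT
  have hφT : ∀ t : LoopSeq d, IsLoopSeq t → φ t = T t := fun t ht =>
    tendsto_nhds_unique (hφ t ht) (H Λ hΛ β hβ t ht).2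
  have hsumm : ∀ t : LoopSeq d, IsLoopSeq t → Summable fun X : Trajectory t => X.weight β := fun t ht =>
    (H Λ hΛ β hβ t ht).1
  -- the first-step identity, as a finite sum over the moves
  letI : Fintype (Move s) := Fintype.ofEquiv _ (Move.equivSum (s := s)).symm
  have h1 : T s = ∑ m : Move s, m.weight β * T m.result := by
    have h := tsum_weight_eq_sum_moves hne β (hsumm s hs) fun m => hsumm _ (hs.moveResult m)
    exact (h.unique (hasSum_fintype _)).symm ▸ rfl
  -- split the sum over the four kinds of moves
  have h2 : ∑ m : Move s, m.weight β * T m.result =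
      ((∑ o : DeformIdx s, (-β / (s.len : ℝ)) * T (s.posDeformAt o)) +
        ∑ o : DeformIdx s, (β / (s.len : ℝ)) * T (s.negDeformAt o)) +
      ((∑ o : SameIdx s, (-1 / (s.len : ℝ)) * T (s.posSplitAt o)) +
        ∑ o : InvIdx s, (1 / (s.len : ℝ)) * T (s.negSplitAt o)) := by
    rw [← (Move.equivSum (s := s)).symm.sum_comp, Fintype.sum_sum_type, Fintype.sum_sum_type, Fintype.sum_sum_type]
    rfl
  -- back to `φ` (all produced loop sequences are genuine)
  have hlen : (s.len : ℝ) ≠ 0 := by exact_mod_cast (LoopSeq.len_pos hs hne).ne'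
  rw [hφT s hs, h1, h2]
  simp only [hφT _ (hs.posDeformAt _), hφT _ (hs.negDeformAt _), hφT _ (hs.posSplitAt _), hφT _ (hs.negSplitAt _),
    ← Finset.mul_sum]
  field_simp
  ring

/-! ### Theorem 9.9 from Theorem 8.1, the printed direction: symmetrization over the marked edge (v1.1)

Printed proofs (§8, proof of Theorem 3.6; §9, Theorem 9.9): «`φ(l_{π(1)}, …, l_{π(n)}) = φ(l₁, …, lₙ)` for any
permutation `π`»; the marked equation holds «if `l₁` is replaced by any other `l_k` and `e` is replaced by any edge in
`l_k`»; «Within the loop `l_k`, declare two edges to be equivalent if they are either equal or inverses of each other. If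
`e` is an edge, then `C_k(e)` is the equivalence class containing `e`. Construct a set `D_k` by taking one member from
each equivalence class and sum both sides … Since `∑_{e∈D_k} m_k(e) = |l_k|` … Summing both sides over `k`, we get the
equation claimed»; Theorem 9.9 «is proved by simply dividing both sides in Theorem 3.6 by `N` and letting `N` tend to
infinity.»  Here the same symmetrization is applied directly to the limiting marked equation of Theorem 9.1 (PROVED from
Theorem 8.1 in the sibling `MasterLoopLimit`), which avoids the limits of the twisting and merger terms; instead of a set
of class representatives `D_k` we average over all marked locations with the weight `1/m_k(e)` (each class `C_k(e)` has
`m_k(e)` members, all with the same right-hand side). -/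

namespace Word

variable (l : Word d)

/-- `x ∈ C(e)` iff `l_x ∈ {e, e⁻¹}`. [cite: Chatterjee2019LargeN, Theorem 8.1 (C₁ = A₁ ∪ B₁)] -/
theorem mem_locs_iff (e : DEdge d) (x : Fin l.length) : x ∈ locs l e ↔ (l.get x = e ∨ l.get x = DEdge.inv e) := by
  simp [locs]

/-- The relation «`l_x` and `l_{x₀}` are equal or inverses of each other» is symmetric.
[cite: Chatterjee2019LargeN, proof of Theorem 3.6 («declare two edges to be equivalent if they are either equal or inverses of each other»)] -/
theorem mem_locs_comm (x x₀ : Fin l.length) : x ∈ locs l (l.get x₀) ↔ x₀ ∈ locs l (l.get x) := by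
  simp only [mem_locs_iff]
  constructor
  · rintro (h | h)
    · exact Or.inl h.symm
    · exact Or.inr (by rw [h, DEdge.inv_inv])
  · rintro (h | h)
    · exact Or.inl h.symm
    · exact Or.inr (by rw [h, DEdge.inv_inv])

/-- `C(e⁻¹) = C(e)`. [cite: Chatterjee2019LargeN, proof of Theorem 3.6 (equivalence classes of edges)] -/
theorem locs_inv (e : DEdge d) : locs l (DEdge.inv e) = locs l e := by
  ext x
  simp only [mem_locs_iff, DEdge.inv_inv]
  exact or_comm

/-- Members of one class have the same class. [cite: Chatterjee2019LargeN, proof of Theorem 3.6 («C_k(e) is the equivalence class containing e»)] -/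
theorem locs_eq_of_mem {e : DEdge d} {x₀ : Fin l.length} (h : x₀ ∈ locs l e) : locs l (l.get x₀) = locs l e := by
  rcases (mem_locs_iff l e x₀).1 h with h | h
  · rw [h]
  · rw [h, locs_inv]

/-- … hence the same multiplicity `m(e) = |C(e)|`. [cite: Chatterjee2019LargeN, proof of Theorem 3.6 (m_k(e) the size of C_k(e))] -/
theorem occ_eq_of_mem {e : DEdge d} {x₀ : Fin l.length} (h : x₀ ∈ locs l e) : occ l (l.get x₀) = occ l e := by
  rw [occ, occ, locs_eq_of_mem l h]

/-- `x ∈ C(l_x)`. [cite: Chatterjee2019LargeN, Theorem 8.1 (e ∈ A₁ at its own location)] -/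
theorem self_mem_locs (x : Fin l.length) : x ∈ locs l (l.get x) :=
  (mem_locs_iff l _ x).2 (Or.inl rfl)

/-- `m(l_x) ≥ 1`. [cite: Chatterjee2019LargeN, Theorem 8.1 (m ≥ 1 for an edge of l₁)] -/
theorem occ_get_pos (x : Fin l.length) : 0 < occ l (l.get x) :=
  Finset.card_pos.2 ⟨x, self_mem_locs l x⟩

/-- `𝒫⁺(e⁻¹) = 𝒫⁺(e)` (plaquettes through the undirected edge). [cite: Chatterjee2019LargeN, §2.2 (𝒫⁺(e))] -/
theorem plaquettesAt_inv (e : DEdge d) : plaquettesAt (DEdge.inv e) = plaquettesAt e := rfl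

/-- Members of one class have the same plaquette set. [cite: Chatterjee2019LargeN, §2.2 (𝒫⁺(e)), proof of Theorem 3.6] -/
theorem plaquettesAt_eq_of_mem {e : DEdge d} {x₀ : Fin l.length} (h : x₀ ∈ locs l e) :
    plaquettesAt (l.get x₀) = plaquettesAt e := by
  rcases (mem_locs_iff l e x₀).1 h with h | h
  · rw [h]
  · rw [h, plaquettesAt_inv]

/-- **Averaging over the marked location.** If, for the marking `e = l_{x₀}`, the marked index set `S(e)` consists of
those `a ∈ T` whose pivot location `π(a)` lies in the class of `x₀`, then
`∑_{x₀} m(l_{x₀})⁻¹ ∑_{a ∈ S(l_{x₀})} F(a) = ∑_{a ∈ T} F(a)` — the tree's form of «construct a set `D_k` by taking one member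
from each equivalence class and sum … `∑_{e∈D_k} m_k(e) = |l_k|`». [cite: Chatterjee2019LargeN, proof of Theorem 3.6 (summation over D_k)] -/
theorem sum_marked_avg {ι : Type*} (T : Finset ι) (S : DEdge d → Finset ι) (π : ι → Fin l.length) (F : ι → ℝ)
    (hS : ∀ (x₀ : Fin l.length) (a : ι), a ∈ S (l.get x₀) ↔ a ∈ T ∧ x₀ ∈ locs l (l.get (π a))) :
    ∑ x₀ : Fin l.length, ((occ l (l.get x₀) : ℝ)⁻¹ * ∑ a ∈ S (l.get x₀), F a) = ∑ a ∈ T, F a := by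
  classical
  calc ∑ x₀ : Fin l.length, ((occ l (l.get x₀) : ℝ)⁻¹ * ∑ a ∈ S (l.get x₀), F a)
      = ∑ x₀ : Fin l.length, ∑ a ∈ T,
          (if x₀ ∈ locs l (l.get (π a)) then (occ l (l.get x₀) : ℝ)⁻¹ * F a else 0) := by
        refine Finset.sum_congr rfl fun x₀ _ => ?_
        rw [Finset.mul_sum, ← Finset.sum_filter]
        refine Finset.sum_congr ?_ fun _ _ => rfl
        ext a
        rw [Finset.mem_filter]
        exact hS x₀ a
    _ = ∑ a ∈ T, ∑ x₀ : Fin l.length,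
          (if x₀ ∈ locs l (l.get (π a)) then (occ l (l.get x₀) : ℝ)⁻¹ * F a else 0) := Finset.sum_comm
    _ = ∑ a ∈ T, F a := by
        refine Finset.sum_congr rfl fun a _ => ?_
        rw [← Finset.sum_filter]
        have hfl : (Finset.univ.filter fun x₀ : Fin l.length => x₀ ∈ locs l (l.get (π a))) = locs l (l.get (π a)) := by
          ext x
          simp
        rw [hfl]
        calc ∑ x₀ ∈ locs l (l.get (π a)), (occ l (l.get x₀) : ℝ)⁻¹ * F a
            = ∑ x₀ ∈ locs l (l.get (π a)), (occ l (l.get (π a)) : ℝ)⁻¹ * F a :=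
              Finset.sum_congr rfl fun x₀ hx₀ => by rw [occ_eq_of_mem l hx₀]
          _ = F a := by
              rw [Finset.sum_const, nsmul_eq_mul]
              have h0 : ((locs l (l.get (π a))).card : ℝ) ≠ 0 := by
                exact_mod_cast (occ_get_pos l (π a)).ne'
              rw [occ]
              field_simp

/-- Averaged over the marking, the negative-splitting index set `A₁ × B₁ ∪ B₁ × A₁` becomes ALL pairs of locations carrying
inverse edges (the component's part of `𝕊⁻(s)`). [cite: Chatterjee2019LargeN, proof of Theorem 3.6 (the sets 𝕊⁻_k(s))] -/
theorem sum_marked_avg_invPairs (F : Fin l.length × Fin l.length → ℝ) :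
    ∑ x₀ : Fin l.length, ((occ l (l.get x₀) : ℝ)⁻¹ * ∑ xy ∈ invPairs l (l.get x₀), F xy)
      = ∑ xy ∈ Finset.univ.filter (fun xy : Fin l.length × Fin l.length => l.get xy.2 = DEdge.inv (l.get xy.1)), F xy := by
  refine sum_marked_avg l _ _ Prod.fst F fun x₀ xy => ?_
  simp only [invPairs, Finset.mem_filter, Finset.mem_univ, true_and, mem_locs_comm l x₀, mem_locs_iff]
  constructor
  · rintro (⟨h1, h2⟩ | ⟨h1, h2⟩)
    · exact ⟨by rw [h2, h1], Or.inl h1⟩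
    · exact ⟨by rw [h2, h1, DEdge.inv_inv], Or.inr h1⟩
  · rintro ⟨h, h1 | h1⟩
    · exact Or.inl ⟨h1, by rw [h, h1]⟩
    · exact Or.inr ⟨h1, by rw [h, h1, DEdge.inv_inv]⟩

/-- Averaged over the marking, the positive-splitting index set (`x ≠ y` both in `A₁` or both in `B₁`) becomes ALL pairs of
distinct locations carrying the same edge (the component's part of `𝕊⁺(s)`). [cite: Chatterjee2019LargeN, proof of Theorem 3.6 (the sets 𝕊⁺_k(s))] -/
theorem sum_marked_avg_samePairs (F : Fin l.length × Fin l.length → ℝ) :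
    ∑ x₀ : Fin l.length, ((occ l (l.get x₀) : ℝ)⁻¹ * ∑ xy ∈ samePairs l (l.get x₀), F xy)
      = ∑ xy ∈ Finset.univ.filter
          (fun xy : Fin l.length × Fin l.length => xy.1 ≠ xy.2 ∧ l.get xy.2 = l.get xy.1), F xy := by
  refine sum_marked_avg l _ _ Prod.fst F fun x₀ xy => ?_
  simp only [samePairs, Finset.mem_filter, Finset.mem_univ, true_and, mem_locs_comm l x₀, mem_locs_iff]
  constructor
  · rintro ⟨h1, h2, h3⟩
    exact ⟨⟨h1, h2.symm⟩, h3⟩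
  · rintro ⟨⟨h1, h2⟩, h3⟩
    exact ⟨h1, h2.symm, h3⟩

/-- Averaged over the marking, the deformation index set `𝒫⁺(e) × C₁` becomes ALL pairs (location `x`, plaquette through
`l_x`) (the component's part of `𝔻^±(s)`). [cite: Chatterjee2019LargeN, proof of Theorem 3.6 (the sets 𝔻^±_k(s))] -/
theorem sum_marked_avg_deform (G : Fin l.length → ZdPlaquette d → ℝ) :
    ∑ x₀ : Fin l.length, ((occ l (l.get x₀) : ℝ)⁻¹ *
        ∑ p ∈ plaquettesAt (l.get x₀), ∑ x ∈ locs l (l.get x₀), G x p)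
      = ∑ x : Fin l.length, ∑ p ∈ plaquettesAt (l.get x), G x p := by
  have h1 : ∀ x₀ : Fin l.length, ∑ p ∈ plaquettesAt (l.get x₀), ∑ x ∈ locs l (l.get x₀), G x p
      = ∑ x ∈ locs l (l.get x₀), ∑ p ∈ plaquettesAt (l.get x), G x p := by
    intro x₀
    rw [Finset.sum_comm]
    exact Finset.sum_congr rfl fun x hx => by rw [plaquettesAt_eq_of_mem l hx]
  simp only [h1]
  exact sum_marked_avg l Finset.univ (fun e => locs l e) id _ fun x₀ x => by
    simp only [Finset.mem_univ, true_and, id]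
    exact mem_locs_comm l x x₀

end Word

/-- `⟨W_{l₁} ⋯ W_{lₙ}⟩` does not depend on the order of the loops: `φ_{Λ,N,β}(l_{π(1)}, …, l_{π(n)}) = φ_{Λ,N,β}(l₁, …, lₙ)`.
[cite: Chatterjee2019LargeN, proof of Theorem 3.6 («φ(l_{π(1)}, …, l_{π(n)}) = φ(l₁, …, lₙ) for any permutation π»)] -/
theorem phi_perm (N : ℕ) (β : ℝ) (Λ : Finset (Literature.Probability.LatticeModels.Site d)) {s t : LoopSeq d}
    (h : s.Perm t) : phi N β Λ s = phi N β Λ t := by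
  have hw : wilsonProd N s = wilsonProd N t := by
    funext U
    exact (h.map _).prod_eq
  rw [phi, phi, hw, h.length_eq]

/-- Genuine loop sequences are closed under permutation. [cite: Chatterjee2019LargeN, §2.1 (loop sequences as collections)] -/
theorem IsLoopSeq.perm {s t : LoopSeq d} (h : s.Perm t) (hs : IsLoopSeq s) : IsLoopSeq t :=
  fun l hl => hs l (h.mem_iff.2 hl)

/-- `lᵢ :: (s without lᵢ)` is a permutation of `s`. [cite: Chatterjee2019LargeN, proof of Theorem 3.6 («if l₁ is replaced by any other l_k»)] -/
theorem LoopSeq.perm_get_cons_eraseIdx : ∀ (s : LoopSeq d) (i : Fin s.length), s.Perm (s.get i :: s.eraseIdx i)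
  | [], i => i.elim0
  | l :: s, ⟨0, _⟩ => List.Perm.refl _
  | l :: s, ⟨i + 1, hi⟩ => by
    have ih := LoopSeq.perm_get_cons_eraseIdx s ⟨i, by simpa using hi⟩
    simp only [List.eraseIdx_cons_succ]
    exact (ih.cons l).trans (List.Perm.swap _ _ _)

/-- `replaceAt` in place versus at the front: `(s with lᵢ ↦ ws)` is a permutation of `prune (ws, s without lᵢ)`.
[cite: Chatterjee2019LargeN, §2.2 (operations on loop sequences), proof of Theorem 3.6 (reordering)] -/
theorem LoopSeq.replaceAt_perm_prune (s : LoopSeq d) (i : Fin s.length) (ws : List (Word d)) :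
    (s.replaceAt i ws).Perm (LoopSeq.prune (ws ++ s.eraseIdx i)) := by
  rw [LoopSeq.replaceAt, LoopSeq.prune, LoopSeq.prune, List.eraseIdx_eq_take_drop_succ]
  refine List.Perm.filter _ ?_
  rw [List.append_assoc]
  exact List.perm_append_comm.trans (by rw [List.append_assoc]; exact List.perm_append_comm.append_left ws)

/-- **One component, symmetrized.** If `φ` is permutation invariant on genuine loop sequences and satisfies the marked
master loop equation of Theorem 9.1 at `β`, then for a genuine `s` and a component `i`:
`|lᵢ| φ(s) = ∑_{𝕊⁻ᵢ(s)} φ(s') − ∑_{𝕊⁺ᵢ(s)} φ(s') + β ∑_{𝔻⁻ᵢ(s)} φ(s') − β ∑_{𝔻⁺ᵢ(s)} φ(s')` (sums over the operations in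
component `i`, as filtered sums of location data). [cite: Chatterjee2019LargeN, proof of Theorem 3.6 (the display for (N−1)|l_k|φ(s), here its N → ∞ form)] -/
theorem symmetrize_component {φ : LoopSeq d → ℝ} {β : ℝ}
    (hperm : ∀ t t' : LoopSeq d, IsLoopSeq t → t.Perm t' → φ t = φ t')
    (hML : SatisfiesMasterLoopEquation φ β) {s : LoopSeq d} (hs : IsLoopSeq s) (i : Fin s.length) :
    ((s.get i).length : ℝ) * φ s =
      (∑ xy ∈ Finset.univ.filter
          (fun xy : Fin (s.get i).length × Fin (s.get i).length => (s.get i).get xy.2 = DEdge.inv ((s.get i).get xy.1)),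
          φ (s.replaceAt i [Word.negSplit₁ (s.get i) xy.1 xy.2, Word.negSplit₂ (s.get i) xy.1 xy.2]))
      - (∑ xy ∈ Finset.univ.filter
          (fun xy : Fin (s.get i).length × Fin (s.get i).length => xy.1 ≠ xy.2 ∧ (s.get i).get xy.2 = (s.get i).get xy.1),
          φ (s.replaceAt i [Word.posSplit₁ (s.get i) xy.1 xy.2, Word.posSplit₂ (s.get i) xy.1 xy.2]))
      + β * (∑ x : Fin (s.get i).length, ∑ p ∈ plaquettesAt ((s.get i).get x),
          φ (s.replaceAt i [Word.negDeform (s.get i) x p]))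
      - β * (∑ x : Fin (s.get i).length, ∑ p ∈ plaquettesAt ((s.get i).get x),
          φ (s.replaceAt i [Word.posDeform (s.get i) x p])) := by
  have hp : s.Perm (s.get i :: s.eraseIdx i) := LoopSeq.perm_get_cons_eraseIdx s i
  have hs' : IsLoopSeq (s.get i :: s.eraseIdx i) := hs.perm hp
  -- the value on results: front form `prune (ws ++ rest)` versus in-place form `replaceAt i ws`
  have hres : ∀ ws : List (Word d), IsLoopSeq (s.replaceAt i ws) →
      φ (LoopSeq.prune (ws ++ s.eraseIdx i)) = φ (s.replaceAt i ws) := fun ws hws =>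
    (hperm _ _ hws (LoopSeq.replaceAt_perm_prune s i ws)).symm
  have ha : ∑ xy ∈ Finset.univ.filter
        (fun xy : Fin (s.get i).length × Fin (s.get i).length => (s.get i).get xy.2 = DEdge.inv ((s.get i).get xy.1)),
        φ (LoopSeq.prune (Word.negSplit₁ (s.get i) xy.1 xy.2 :: Word.negSplit₂ (s.get i) xy.1 xy.2 :: s.eraseIdx i))
      = ∑ xy ∈ Finset.univ.filter
        (fun xy : Fin (s.get i).length × Fin (s.get i).length => (s.get i).get xy.2 = DEdge.inv ((s.get i).get xy.1)),
        φ (s.replaceAt i [Word.negSplit₁ (s.get i) xy.1 xy.2, Word.negSplit₂ (s.get i) xy.1 xy.2]) :=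
    Finset.sum_congr rfl fun xy hxy => by
      rw [Finset.mem_filter] at hxy
      exact hres [_, _] (hs.negSplitAt ⟨i, ⟨xy, hxy.2⟩⟩)
  have hb : ∑ xy ∈ Finset.univ.filter
        (fun xy : Fin (s.get i).length × Fin (s.get i).length => xy.1 ≠ xy.2 ∧ (s.get i).get xy.2 = (s.get i).get xy.1),
        φ (LoopSeq.prune (Word.posSplit₁ (s.get i) xy.1 xy.2 :: Word.posSplit₂ (s.get i) xy.1 xy.2 :: s.eraseIdx i))
      = ∑ xy ∈ Finset.univ.filter
        (fun xy : Fin (s.get i).length × Fin (s.get i).length => xy.1 ≠ xy.2 ∧ (s.get i).get xy.2 = (s.get i).get xy.1),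
        φ (s.replaceAt i [Word.posSplit₁ (s.get i) xy.1 xy.2, Word.posSplit₂ (s.get i) xy.1 xy.2]) :=
    Finset.sum_congr rfl fun xy hxy => by
      rw [Finset.mem_filter] at hxy
      exact hres [_, _] (hs.posSplitAt ⟨i, ⟨xy, hxy.2⟩⟩)
  have hc : ∑ x : Fin (s.get i).length, ∑ p ∈ plaquettesAt ((s.get i).get x),
        φ (LoopSeq.prune (Word.negDeform (s.get i) x p :: s.eraseIdx i))
      = ∑ x : Fin (s.get i).length, ∑ p ∈ plaquettesAt ((s.get i).get x),
        φ (s.replaceAt i [Word.negDeform (s.get i) x p]) :=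
    Finset.sum_congr rfl fun x _ => Finset.sum_congr rfl fun p hp =>
      hres [_] (hs.negDeformAt ⟨i, x, ⟨p, hp⟩⟩)
  have hd : ∑ x : Fin (s.get i).length, ∑ p ∈ plaquettesAt ((s.get i).get x),
        φ (LoopSeq.prune (Word.posDeform (s.get i) x p :: s.eraseIdx i))
      = ∑ x : Fin (s.get i).length, ∑ p ∈ plaquettesAt ((s.get i).get x),
        φ (s.replaceAt i [Word.posDeform (s.get i) x p]) :=
    Finset.sum_congr rfl fun x _ => Finset.sum_congr rfl fun p hp =>
      hres [_] (hs.posDeformAt ⟨i, x, ⟨p, hp⟩⟩)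
  -- the marked equation at each location, divided by the multiplicity
  have hx : ∀ x₀ : Fin (s.get i).length, φ s =
      ((Word.occ (s.get i) ((s.get i).get x₀) : ℝ)⁻¹ *
          splitTermAt (fun s' => φ (LoopSeq.prune s')) (s.get i) (s.eraseIdx i) ((s.get i).get x₀))
        + β * (((Word.occ (s.get i) ((s.get i).get x₀) : ℝ)⁻¹) *
          deformTermAt (fun s' => φ (LoopSeq.prune s')) (s.get i) (s.eraseIdx i) ((s.get i).get x₀)) := by
    intro x₀
    have h := hML (s.get i) (s.eraseIdx i) hs' x₀
    have h0 : (Word.occ (s.get i) ((s.get i).get x₀) : ℝ) ≠ 0 := by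
      exact_mod_cast (Word.occ_get_pos (s.get i) x₀).ne'
    rw [hperm s _ hs hp]
    field_simp
    linear_combination h
  -- sum over the marked location
  have hsum : ∑ _x₀ : Fin (s.get i).length, φ s = ∑ x₀ : Fin (s.get i).length,
      (((Word.occ (s.get i) ((s.get i).get x₀) : ℝ)⁻¹ *
          splitTermAt (fun s' => φ (LoopSeq.prune s')) (s.get i) (s.eraseIdx i) ((s.get i).get x₀))
        + β * (((Word.occ (s.get i) ((s.get i).get x₀) : ℝ)⁻¹) *
          deformTermAt (fun s' => φ (LoopSeq.prune s')) (s.get i) (s.eraseIdx i) ((s.get i).get x₀))) :=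
    Finset.sum_congr rfl fun x₀ _ => hx x₀
  rw [Finset.sum_const, Finset.card_univ, Fintype.card_fin, nsmul_eq_mul, Finset.sum_add_distrib,
    ← Finset.mul_sum] at hsum
  rw [hsum]
  -- identify the averaged marked sums with the component's operation sums
  simp only [splitTermAt, deformTermAt, mul_sub, Finset.sum_sub_distrib, Word.sum_marked_avg_invPairs,
    Word.sum_marked_avg_samePairs, Word.sum_marked_avg_deform, ha, hb, hc, hd]
  ring

/-- ★ **Theorem 9.9 from Theorem 8.1 (through Theorem 9.1), PROVED — the printed direction.**  For every `d ≥ 2`, every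
exhaustion, EVERY `β` (the equation of Theorem 9.1 holds «irrespective of the value of β»; the fact asks for some
`β₀ > 0`, we give `β₀ = 1`) and every `φ` that is the limit of `φ_{Λ_N,N,β}` on genuine loop sequences: `φ` is
permutation invariant (`phi_perm`), satisfies the marked equation of Theorem 9.1 at every marked location of the first
component (`MasterLoopLimit.thooftMasterLoopEquation_of_unsymmetrized`, from Theorem 8.1), hence — marking each
component in turn and averaging over the marked location, `symmetrize_component` — the symmetrized equation of
Theorem 9.9.  Supersedes `symmetrizedLimitMasterLoopEquation_of_gaugeStringDuality` as a route to the named fact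
`SymmetrizedLimitMasterLoopEquation` (now ⇐ Theorem 8.1 alone).
[cite: Chatterjee2019LargeN, Theorem 9.9 and its proof; proof of Theorem 3.6 (symmetrization); Theorem 9.1] -/
theorem symmetrizedLimitMasterLoopEquation_of_unsymmetrized (hU : UnsymmetrizedMasterLoopEquation d) :
    SymmetrizedLimitMasterLoopEquation d := by
  intro hd
  refine ⟨1, one_pos, fun Λ hΛ β _ φ hφ s hs _ => ?_⟩
  -- permutation invariance of the limit on genuine loop sequences
  have hperm : ∀ t t' : LoopSeq d, IsLoopSeq t → t.Perm t' → φ t = φ t' := fun t t' ht htt' =>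
    tendsto_nhds_unique (hφ t ht) ((hφ t' (ht.perm htt')).congr fun N => (phi_perm N β (Λ N) htt').symm)
  -- the marked equation of Theorem 9.1 (from Theorem 8.1), along the full sequence of `N`'s
  have hML : SatisfiesMasterLoopEquation φ β :=
    thooftMasterLoopEquation_of_unsymmetrized hU hd Λ hΛ β id strictMono_id φ fun t ht => hφ t ht
  -- the four operation sums, component by component
  have hI : ∑ o : InvIdx s, φ (s.negSplitAt o) = ∑ i : Fin s.length, ∑ xy ∈ Finset.univ.filter
      (fun xy : Fin (s.get i).length × Fin (s.get i).length => (s.get i).get xy.2 = DEdge.inv ((s.get i).get xy.1)),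
      φ (s.replaceAt i [Word.negSplit₁ (s.get i) xy.1 xy.2, Word.negSplit₂ (s.get i) xy.1 xy.2]) := by
    rw [Fintype.sum_sigma]
    refine Finset.sum_congr rfl fun i _ => ?_
    symm
    apply Finset.sum_subtype
    intro xy
    simp
  have hS : ∑ o : SameIdx s, φ (s.posSplitAt o) = ∑ i : Fin s.length, ∑ xy ∈ Finset.univ.filter
      (fun xy : Fin (s.get i).length × Fin (s.get i).length => xy.1 ≠ xy.2 ∧ (s.get i).get xy.2 = (s.get i).get xy.1),
      φ (s.replaceAt i [Word.posSplit₁ (s.get i) xy.1 xy.2, Word.posSplit₂ (s.get i) xy.1 xy.2]) := by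
    rw [Fintype.sum_sigma]
    refine Finset.sum_congr rfl fun i _ => ?_
    symm
    apply Finset.sum_subtype
    intro xy
    simp
  have hDn : ∑ o : DeformIdx s, φ (s.negDeformAt o) = ∑ i : Fin s.length, ∑ x : Fin (s.get i).length,
      ∑ p ∈ plaquettesAt ((s.get i).get x), φ (s.replaceAt i [Word.negDeform (s.get i) x p]) := by
    rw [Fintype.sum_sigma]
    refine Finset.sum_congr rfl fun i _ => ?_
    rw [Fintype.sum_sigma]
    refine Finset.sum_congr rfl fun x _ => ?_
    exact Finset.sum_coe_sort (plaquettesAt ((s.get i).get x))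
      (fun p => φ (s.replaceAt i [Word.negDeform (s.get i) x p]))
  have hDp : ∑ o : DeformIdx s, φ (s.posDeformAt o) = ∑ i : Fin s.length, ∑ x : Fin (s.get i).length,
      ∑ p ∈ plaquettesAt ((s.get i).get x), φ (s.replaceAt i [Word.posDeform (s.get i) x p]) := by
    rw [Fintype.sum_sigma]
    refine Finset.sum_congr rfl fun i _ => ?_
    rw [Fintype.sum_sigma]
    refine Finset.sum_congr rfl fun x _ => ?_
    exact Finset.sum_coe_sort (plaquettesAt ((s.get i).get x))
      (fun p => φ (s.replaceAt i [Word.posDeform (s.get i) x p]))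
  -- sum the componentwise identities over the components
  have hlhs : (s.len : ℝ) * φ s = ∑ i : Fin s.length, ((s.get i).length : ℝ) * φ s := by
    rw [← Finset.sum_mul, CoeffCatalanBoundProof.sum_length_get]
  rw [hlhs, Finset.sum_congr rfl fun i _ => symmetrize_component hperm hML hs i, hI, hS, hDn, hDp]
  simp only [Finset.sum_add_distrib, Finset.sum_sub_distrib, Finset.mul_sum]

end Literature.MathematicalPhysics.QuantumFieldTheory.Chatterjee2019LargeN

end
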